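import Summits.CriticalPhenomena.PercolationContinuityZ3.Theorems.PercNearOneGluingNoHeavyLowerTailOneCutFiveThreePort
import Summits.CriticalPhenomena.PercolationContinuityZ3.Theorems.PercNearOneGluingNoHeavyLowerTailOneCutFiveZeroOneHalf
import HarnessLib

/-!
# `Z(3,2)` at a three-port observer: the two TRANSFER identities and three hypothesis-free sufficient conditions

builds on p205010 (kernel theorem, internal audit signed; external expert review pending)

Support file (`--supports stmt-CriticalPhenomena-4575`), seat `prim-quant-p1` (gen 3); memo `run/shared/lean/prim/quant/P1-SURPLUS.md` §13.8–13.9.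
No definitions, no named facts, no sorries.

Setting of `…OneCutFiveThreePort` (p214706): `o` a three-port observer (all its positive hairs go to `a, b, c`), hairs `α, β, γ`,
off-`o` three-point cells `U0, Uab, Uac, Ubc, U3` of `(a,b,c)` (Gladkov's `P(a|b|c), P(ab|c), P(ac|b), P(a|bc), P(abc)`),
`margin := μ(B={b,c}) − μ(B={a}) = U0·T + Ubc·V` with `T = (1−α)βγ − α(1−β)(1−γ)`, `V = β+γ−βγ−α` (`ThreePort.margin_eq`).
This file adds:

* `ThreePort.cells_sum_eq_one` — `Uab + Uac + Ubc + U3 + U0 = 1`.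
* `ThreePort.openConn_b_sub_a` — `μ(o↔b) − μ(o↔a) = (β−α)(U0 + Uac + Ubc) + γ[(1−β)Ubc − (1−α)Uac]` (and `_c_sub_a`).
* `ThreePort.margin_eq_transfer_b` — the TRANSFER IDENTITY
  `margin = (μ(o↔b) − μ(o↔a)) + [(α−β) + γ(1−α)]·Uac − W_b·U0`,  `W_b := (1−α)β(1−γ) − α(1−β)γ`  (and `_c`: `Uab`, `W_c`).
  So at the argmin `a` the margin is controlled by ONE apex-pair cell against the all-apart cell: `Z(3,2)`'s conclusion holds as soon as
  `[(α−β)+γ(1−α)]·Uac ≥ W_b·U0` OR `[(α−γ)+β(1−α)]·Uab ≥ W_c·U0` (`single_le_pair_of_transfer_b/_c`), OR the star criterion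
  `T ≥ 0`, i.e. `odds(β)·odds(γ) ≥ odds(α)` (`single_le_pair_of_star`, which contains the heavy-hair theorem
  `pocketExchange_of_half_le_hair` of p214706) — none of the three uses `Σ q > 2`.  The RESIDUAL of `Z(3,2)` at a three-port observer is
  therefore `{T < 0, Uac < κ_b U0, Uab < κ_c U0}` (both apex pairs small against `a|b|c`), where the mean hypothesis must act; for
  the off-`o` graph = a triangle (all graphs on ≤ 4 vertices) the memo closes it by an exact interval certificate (§13.8).
* `ThreePort.le_one_reached_le_of_transfer` — the `Z(3,2)`-shaped conclusion `μ{o reaches ≤ 1 of {a,b,c}} ≤ t` (`t ≥ μ(o↮a)`) under any of the three conditions.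
[cite: Gladkov2024, Def. 2.1 (p. 3)] (three-point cells); [cite: KozmaNitzan2024, Conjecture 3 (p. 15)] (context).
-/

noncomputable section

namespace Summit.CriticalPhenomena.PercolationContinuityZ3.Theorems

open MeasureTheory Set Literature.Probability.LatticeModels Literature.Probability.Percolation
open scoped Classical BigOperators

variable {n : ℕ}

namespace ThreePort

section Transfer

variable (w : Sym2 (Fin n) → unitInterval) (o a b c : Fin n) (hao : a ≠ o) (hbo : b ≠ o) (hco : c ≠ o)
  (hab : a ≠ b) (hac : a ≠ c) (hbc : b ≠ c) (hobs : ∀ u, u ≠ o → u ≠ a → u ≠ b → u ≠ c → w s(o, u) = 0)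

/-- **The five three-point cells sum to one**: `Uab + Uac + Ubc + U3 + U0 = 1` for the off-`o` connectivity of `(a,b,c)`. [folklore] -/
theorem cells_sum_eq_one :
    (prodBernoulli w).real {ω | (openGraph (ω ∩ {e | o ∉ e})).Reachable a b ∧ ¬ (openGraph (ω ∩ {e | o ∉ e})).Reachable a c} +
      (prodBernoulli w).real {ω | (openGraph (ω ∩ {e | o ∉ e})).Reachable a c ∧ ¬ (openGraph (ω ∩ {e | o ∉ e})).Reachable a b} +
      (prodBernoulli w).real {ω | (openGraph (ω ∩ {e | o ∉ e})).Reachable b c ∧ ¬ (openGraph (ω ∩ {e | o ∉ e})).Reachable a b} +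
      (prodBernoulli w).real {ω | (openGraph (ω ∩ {e | o ∉ e})).Reachable a b ∧ (openGraph (ω ∩ {e | o ∉ e})).Reachable a c} +
      (prodBernoulli w).real {ω | ¬ (openGraph (ω ∩ {e | o ∉ e})).Reachable a b ∧
        ¬ (openGraph (ω ∩ {e | o ∉ e})).Reachable a c ∧ ¬ (openGraph (ω ∩ {e | o ∉ e})).Reachable b c} = 1 := by
  set μ := prodBernoulli w with hμ
  set G : BondConfig (Fin n) → SimpleGraph (Fin n) := fun ω => openGraph (ω ∩ {e | o ∉ e}) with hG
  have h1 : μ.real {ω | (G ω).Reachable a b} =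
      μ.real {ω | (G ω).Reachable a b ∧ ¬ (G ω).Reachable a c} + μ.real {ω | (G ω).Reachable a b ∧ (G ω).Reachable a c} :=
    real_Rab μ G a b c
  have h2 : μ.real {ω | ¬ (G ω).Reachable a b} =
      μ.real {ω | (G ω).Reachable a c ∧ ¬ (G ω).Reachable a b} +
        μ.real {ω | ¬ (G ω).Reachable a b ∧ ¬ (G ω).Reachable a c} := by
    refine real_eq_add_of_iff μ (fun ω => ?_) (fun ω h1 h2 => h2.2 h1.1)
    simp only [mem_setOf_eq]
    constructor
    · intro h
      by_cases hc : (G ω).Reachable a c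
      · exact Or.inl ⟨hc, h⟩
      · exact Or.inr ⟨h, hc⟩
    · rintro (⟨-, h⟩ | ⟨h, -⟩) <;> exact h
  have h3 : μ.real {ω | ¬ (G ω).Reachable a b ∧ ¬ (G ω).Reachable a c} =
      μ.real {ω | (G ω).Reachable b c ∧ ¬ (G ω).Reachable a b} +
        μ.real {ω | ¬ (G ω).Reachable a b ∧ ¬ (G ω).Reachable a c ∧ ¬ (G ω).Reachable b c} :=
    real_notR_notR μ G a b c
  have h4 : μ.real {ω | ¬ (G ω).Reachable a b} = 1 - μ.real {ω | (G ω).Reachable a b} := by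
    have : {ω | ¬ (G ω).Reachable a b} = {ω | (G ω).Reachable a b}ᶜ := by ext ω; simp
    rw [this, probReal_compl_eq_one_sub MeasurableSet.of_discrete]
  show μ.real {ω | (G ω).Reachable a b ∧ ¬ (G ω).Reachable a c} + μ.real {ω | (G ω).Reachable a c ∧ ¬ (G ω).Reachable a b} +
      μ.real {ω | (G ω).Reachable b c ∧ ¬ (G ω).Reachable a b} + μ.real {ω | (G ω).Reachable a b ∧ (G ω).Reachable a c} +
      μ.real {ω | ¬ (G ω).Reachable a b ∧ ¬ (G ω).Reachable a c ∧ ¬ (G ω).Reachable b c} = 1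
  linarith

include hao hbo hco hab hac hbc hobs

/-- **`μ(o↔b) − μ(o↔a)` in cells**: `(β−α)(U0 + Uac + Ubc) + γ[(1−β)·Ubc − (1−α)·Uac]` at a three-port observer. [this work] -/
theorem openConn_b_sub_a :
    (prodBernoulli w).real (openConn o b) - (prodBernoulli w).real (openConn o a) =
      ((w s(o, b) : ℝ) - w s(o, a)) *
          ((prodBernoulli w).real {ω | ¬ (openGraph (ω ∩ {e | o ∉ e})).Reachable a b ∧
              ¬ (openGraph (ω ∩ {e | o ∉ e})).Reachable a c ∧ ¬ (openGraph (ω ∩ {e | o ∉ e})).Reachable b c} +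
            (prodBernoulli w).real {ω | (openGraph (ω ∩ {e | o ∉ e})).Reachable a c ∧ ¬ (openGraph (ω ∩ {e | o ∉ e})).Reachable a b} +
            (prodBernoulli w).real {ω | (openGraph (ω ∩ {e | o ∉ e})).Reachable b c ∧ ¬ (openGraph (ω ∩ {e | o ∉ e})).Reachable a b}) +
        w s(o, c) * ((1 - w s(o, b)) *
            (prodBernoulli w).real {ω | (openGraph (ω ∩ {e | o ∉ e})).Reachable b c ∧ ¬ (openGraph (ω ∩ {e | o ∉ e})).Reachable a b} -
          (1 - w s(o, a)) *
            (prodBernoulli w).real {ω | (openGraph (ω ∩ {e | o ∉ e})).Reachable a c ∧ ¬ (openGraph (ω ∩ {e | o ∉ e})).Reachable a b}) := by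
  have hsum := cells_sum_eq_one w o a b c
  rw [real_openConn_b w o a b c hao hbo hco hab hac hbc hobs, real_openConn w o a b c hao hbo hco hab hac hbc hobs]
  linear_combination ((w s(o, a) : ℝ) - w s(o, b)) * hsum

/-- **`μ(o↔c) − μ(o↔a)` in cells**: `(γ−α)(U0 + Uab + Ubc) + β[(1−γ)·Ubc − (1−α)·Uab]`. [this work] -/
theorem openConn_c_sub_a :
    (prodBernoulli w).real (openConn o c) - (prodBernoulli w).real (openConn o a) =
      ((w s(o, c) : ℝ) - w s(o, a)) *
          ((prodBernoulli w).real {ω | ¬ (openGraph (ω ∩ {e | o ∉ e})).Reachable a b ∧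
              ¬ (openGraph (ω ∩ {e | o ∉ e})).Reachable a c ∧ ¬ (openGraph (ω ∩ {e | o ∉ e})).Reachable b c} +
            (prodBernoulli w).real {ω | (openGraph (ω ∩ {e | o ∉ e})).Reachable a b ∧ ¬ (openGraph (ω ∩ {e | o ∉ e})).Reachable a c} +
            (prodBernoulli w).real {ω | (openGraph (ω ∩ {e | o ∉ e})).Reachable b c ∧ ¬ (openGraph (ω ∩ {e | o ∉ e})).Reachable a b}) +
        w s(o, b) * ((1 - w s(o, c)) *
            (prodBernoulli w).real {ω | (openGraph (ω ∩ {e | o ∉ e})).Reachable b c ∧ ¬ (openGraph (ω ∩ {e | o ∉ e})).Reachable a b} -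
          (1 - w s(o, a)) *
            (prodBernoulli w).real {ω | (openGraph (ω ∩ {e | o ∉ e})).Reachable a b ∧ ¬ (openGraph (ω ∩ {e | o ∉ e})).Reachable a c}) := by
  have hsum := cells_sum_eq_one w o a b c
  rw [real_openConn_c w o a b c hao hbo hco hab hac hbc hobs, real_openConn w o a b c hao hbo hco hab hac hbc hobs]
  linear_combination ((w s(o, a) : ℝ) - w s(o, c)) * hsum

/-- **Transfer identity (via `b`).**  At a three-port observer,
`μ(B={b,c}) − μ(B={a}) = (μ(o↔b) − μ(o↔a)) + [(α−β) + γ(1−α)]·Uac − [(1−α)β(1−γ) − α(1−β)γ]·U0`: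
once `a` is no more likely than `b`, the pocket-exchange margin is a contest between the apex-pair cell `ac|b` and the all-apart cell `a|b|c`
with explicit hair coefficients. [this work] -/
theorem margin_eq_transfer_b :
    (prodBernoulli w).real {ω | ω ∉ openConn o a ∧ ω ∈ openConn o b ∧ ω ∈ openConn o c} -
        (prodBernoulli w).real {ω | ω ∈ openConn o a ∧ ω ∉ openConn o b ∧ ω ∉ openConn o c} =
      ((prodBernoulli w).real (openConn o b) - (prodBernoulli w).real (openConn o a)) +
        (((w s(o, a) : ℝ) - w s(o, b)) + w s(o, c) * (1 - w s(o, a))) *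
          (prodBernoulli w).real {ω | (openGraph (ω ∩ {e | o ∉ e})).Reachable a c ∧ ¬ (openGraph (ω ∩ {e | o ∉ e})).Reachable a b} -
        ((1 - w s(o, a)) * w s(o, b) * (1 - w s(o, c)) - w s(o, a) * (1 - w s(o, b)) * w s(o, c)) *
          (prodBernoulli w).real {ω | ¬ (openGraph (ω ∩ {e | o ∉ e})).Reachable a b ∧
            ¬ (openGraph (ω ∩ {e | o ∉ e})).Reachable a c ∧ ¬ (openGraph (ω ∩ {e | o ∉ e})).Reachable b c} := by
  rw [margin_eq w o a b c hao hbo hco hab hac hbc hobs, openConn_b_sub_a w o a b c hao hbo hco hab hac hbc hobs]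
  ring

/-- **Transfer identity (via `c`).**  `μ(B={b,c}) − μ(B={a}) = (μ(o↔c) − μ(o↔a)) + [(α−γ) + β(1−α)]·Uab − [(1−α)γ(1−β) − α(1−γ)β]·U0`. [this work] -/
theorem margin_eq_transfer_c :
    (prodBernoulli w).real {ω | ω ∉ openConn o a ∧ ω ∈ openConn o b ∧ ω ∈ openConn o c} -
        (prodBernoulli w).real {ω | ω ∈ openConn o a ∧ ω ∉ openConn o b ∧ ω ∉ openConn o c} =
      ((prodBernoulli w).real (openConn o c) - (prodBernoulli w).real (openConn o a)) +
        (((w s(o, a) : ℝ) - w s(o, c)) + w s(o, b) * (1 - w s(o, a))) *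
          (prodBernoulli w).real {ω | (openGraph (ω ∩ {e | o ∉ e})).Reachable a b ∧ ¬ (openGraph (ω ∩ {e | o ∉ e})).Reachable a c} -
        ((1 - w s(o, a)) * w s(o, c) * (1 - w s(o, b)) - w s(o, a) * (1 - w s(o, c)) * w s(o, b)) *
          (prodBernoulli w).real {ω | ¬ (openGraph (ω ∩ {e | o ∉ e})).Reachable a b ∧
            ¬ (openGraph (ω ∩ {e | o ∉ e})).Reachable a c ∧ ¬ (openGraph (ω ∩ {e | o ∉ e})).Reachable b c} := by
  rw [margin_eq w o a b c hao hbo hco hab hac hbc hobs, openConn_c_sub_a w o a b c hao hbo hco hab hac hbc hobs]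
  ring

/-- **Sufficient condition (B): the `ac`-pair beats `a|b|c`.**  If `μ(o↔a) ≤ μ(o↔b)` and
`[(α−β) + γ(1−α)]·Uac ≥ [(1−α)β(1−γ) − α(1−β)γ]·U0`, then `μ(B={a}) ≤ μ(B={b,c})` — no hypothesis on `Σ q`. [this work] -/
theorem single_le_pair_of_transfer_b
    (hqab : (prodBernoulli w).real (openConn o a) ≤ (prodBernoulli w).real (openConn o b))
    (htr : ((1 - (w s(o, a) : ℝ)) * w s(o, b) * (1 - w s(o, c)) - w s(o, a) * (1 - w s(o, b)) * w s(o, c)) *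
        (prodBernoulli w).real {ω | ¬ (openGraph (ω ∩ {e | o ∉ e})).Reachable a b ∧
          ¬ (openGraph (ω ∩ {e | o ∉ e})).Reachable a c ∧ ¬ (openGraph (ω ∩ {e | o ∉ e})).Reachable b c} ≤
      (((w s(o, a) : ℝ) - w s(o, b)) + w s(o, c) * (1 - w s(o, a))) *
        (prodBernoulli w).real {ω | (openGraph (ω ∩ {e | o ∉ e})).Reachable a c ∧ ¬ (openGraph (ω ∩ {e | o ∉ e})).Reachable a b}) :
    (prodBernoulli w).real {ω | ω ∈ openConn o a ∧ ω ∉ openConn o b ∧ ω ∉ openConn o c} ≤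
      (prodBernoulli w).real {ω | ω ∉ openConn o a ∧ ω ∈ openConn o b ∧ ω ∈ openConn o c} := by
  have h := margin_eq_transfer_b w o a b c hao hbo hco hab hac hbc hobs
  linarith

/-- **Sufficient condition (C): the `ab`-pair beats `a|b|c`** (symmetric to (B), using `μ(o↔a) ≤ μ(o↔c)`). [this work] -/
theorem single_le_pair_of_transfer_c
    (hqac : (prodBernoulli w).real (openConn o a) ≤ (prodBernoulli w).real (openConn o c))
    (htr : ((1 - (w s(o, a) : ℝ)) * w s(o, c) * (1 - w s(o, b)) - w s(o, a) * (1 - w s(o, c)) * w s(o, b)) *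
        (prodBernoulli w).real {ω | ¬ (openGraph (ω ∩ {e | o ∉ e})).Reachable a b ∧
          ¬ (openGraph (ω ∩ {e | o ∉ e})).Reachable a c ∧ ¬ (openGraph (ω ∩ {e | o ∉ e})).Reachable b c} ≤
      (((w s(o, a) : ℝ) - w s(o, c)) + w s(o, b) * (1 - w s(o, a))) *
        (prodBernoulli w).real {ω | (openGraph (ω ∩ {e | o ∉ e})).Reachable a b ∧ ¬ (openGraph (ω ∩ {e | o ∉ e})).Reachable a c}) :
    (prodBernoulli w).real {ω | ω ∈ openConn o a ∧ ω ∉ openConn o b ∧ ω ∉ openConn o c} ≤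
      (prodBernoulli w).real {ω | ω ∉ openConn o a ∧ ω ∈ openConn o b ∧ ω ∈ openConn o c} := by
  have h := margin_eq_transfer_c w o a b c hao hbo hco hab hac hbc hobs
  linarith

/-- **Sufficient condition (A): the star criterion.**  If `μ(o↔a) ≤ μ(o↔b)` and `(1−α)βγ ≥ α(1−β)(1−γ)`
(`odds(β)·odds(γ) ≥ odds(α)`), then `μ(B={a}) ≤ μ(B={b,c})` — no hypothesis on `Σ q`.  Proof: `margin = U0·T + Ubc·V` with `T ≥ 0`;
if `V ≥ 0` done; if `V < 0` then `α > β`, and `μ(o↔b) ≥ μ(o↔a)` in cells forces `U0 = Ubc = 0`.  Contains the heavy-hair theorem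
(`pocketExchange_of_half_le_hair`: lightest hair at `a` and some hair `≥ ½` imply `T ≥ 0`). [this work] -/
theorem single_le_pair_of_star
    (hqab : (prodBernoulli w).real (openConn o a) ≤ (prodBernoulli w).real (openConn o b))
    (hT : (w s(o, a) : ℝ) * (1 - w s(o, b)) * (1 - w s(o, c)) ≤ (1 - w s(o, a)) * w s(o, b) * w s(o, c)) :
    (prodBernoulli w).real {ω | ω ∈ openConn o a ∧ ω ∉ openConn o b ∧ ω ∉ openConn o c} ≤
      (prodBernoulli w).real {ω | ω ∉ openConn o a ∧ ω ∈ openConn o b ∧ ω ∈ openConn o c} := by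
  have hm := margin_eq w o a b c hao hbo hco hab hac hbc hobs
  have hd := openConn_b_sub_a w o a b c hao hbo hco hab hac hbc hobs
  set μ := prodBernoulli w with hμ
  set α : ℝ := (w s(o, a) : ℝ) with hα
  set β : ℝ := (w s(o, b) : ℝ) with hβ
  set γ : ℝ := (w s(o, c) : ℝ) with hγ
  set U0 := μ.real {ω | ¬ (openGraph (ω ∩ {e | o ∉ e})).Reachable a b ∧
      ¬ (openGraph (ω ∩ {e | o ∉ e})).Reachable a c ∧ ¬ (openGraph (ω ∩ {e | o ∉ e})).Reachable b c} with hU0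
  set Uac := μ.real {ω | (openGraph (ω ∩ {e | o ∉ e})).Reachable a c ∧ ¬ (openGraph (ω ∩ {e | o ∉ e})).Reachable a b} with hUac
  set Ubc := μ.real {ω | (openGraph (ω ∩ {e | o ∉ e})).Reachable b c ∧ ¬ (openGraph (ω ∩ {e | o ∉ e})).Reachable a b} with hUbc
  have hU0 : 0 ≤ U0 := measureReal_nonneg
  have hUac0 : 0 ≤ Uac := measureReal_nonneg
  have hUbc0 : 0 ≤ Ubc := measureReal_nonneg
  have hα0 : 0 ≤ α := unitInterval.nonneg _
  have hα1 : α ≤ 1 := unitInterval.le_one _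
  have hβ0 : 0 ≤ β := unitInterval.nonneg _
  have hβ1 : β ≤ 1 := unitInterval.le_one _
  have hγ0 : 0 ≤ γ := unitInterval.nonneg _
  have hγ1 : γ ≤ 1 := unitInterval.le_one _
  -- `q_b − q_a ≥ 0` in cells
  have hHb : 0 ≤ (β - α) * (U0 + Uac + Ubc) + γ * ((1 - β) * Ubc - (1 - α) * Uac) := by rw [← hd]; linarith
  by_cases hV : 0 ≤ β + γ - β * γ - α
  · -- both summands of the margin are nonnegative
    have h1 : 0 ≤ U0 * ((1 - α) * β * γ - α * (1 - β) * (1 - γ)) := mul_nonneg hU0 (by linarith)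
    have h2 : 0 ≤ Ubc * (β + γ - β * γ - α) := mul_nonneg hUbc0 hV
    linarith
  · -- `V < 0`: then `α > β`, and `q_b ≥ q_a` forces `U0 = Ubc = 0`
    have hV' : β + γ - β * γ - α < 0 := lt_of_not_ge hV
    have hαβ : β < α := by nlinarith [mul_nonneg hγ0 (sub_nonneg.2 hβ1)]
    -- from hHb: (α−β) U0 + [(α−β) + γ(1−α)] Uac ≤ V·Ubc ≤ 0
    have hkey : (α - β) * U0 + ((α - β) + γ * (1 - α)) * Uac ≤ (β + γ - β * γ - α) * Ubc := by linarith
    have hUbc_zero : Ubc = 0 := by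
      by_contra hne
      have hpos : 0 < Ubc := lt_of_le_of_ne hUbc0 (Ne.symm hne)
      have : (β + γ - β * γ - α) * Ubc < 0 := mul_neg_of_neg_of_pos hV' hpos
      nlinarith [mul_nonneg (sub_nonneg.2 (le_of_lt hαβ)) hU0,
        mul_nonneg (add_nonneg (sub_nonneg.2 (le_of_lt hαβ)) (mul_nonneg hγ0 (sub_nonneg.2 hα1))) hUac0]
    have hU0_zero : U0 = 0 := by
      by_contra hne
      have hpos : 0 < U0 := lt_of_le_of_ne hU0 (Ne.symm hne)
      have : 0 < (α - β) * U0 := mul_pos (by linarith) hpos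
      rw [hUbc_zero, mul_zero] at hkey
      nlinarith [mul_nonneg (add_nonneg (sub_nonneg.2 (le_of_lt hαβ)) (mul_nonneg hγ0 (sub_nonneg.2 hα1))) hUac0]
    rw [hU0_zero, hUbc_zero] at hm
    linarith

/-- **`Z(3,2)`'s conclusion at a three-port observer under (A), (B) or (C).**  For `R = {a,b,c}` (distinct), the argmin `a`
(`μ(o↔a) ≤ μ(o↔b), μ(o↔c)`) and every `t ≥ μ(o↮a)`: if the star criterion (A) or one of the transfer conditions (B), (C) holds, then
`μ{o reaches at most one vertex of R} ≤ t` — the conclusion of `OneCutFive.ZeroOneThree`, WITHOUT its hypothesis `Σ q > 2`.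
The complement (all three fail) is the residual where `Σ q > 2` must act (memo §13.8: certified for all graphs on ≤ 4 vertices). [this work] -/
theorem le_one_reached_le_of_transfer (R : Finset (Fin n)) (t : ℝ) (hR : R = {a, b, c})
    (hqab : (prodBernoulli w).real (openConn o a) ≤ (prodBernoulli w).real (openConn o b))
    (hqac : (prodBernoulli w).real (openConn o a) ≤ (prodBernoulli w).real (openConn o c))
    (hABC : (w s(o, a) : ℝ) * (1 - w s(o, b)) * (1 - w s(o, c)) ≤ (1 - w s(o, a)) * w s(o, b) * w s(o, c) ∨
      ((1 - (w s(o, a) : ℝ)) * w s(o, b) * (1 - w s(o, c)) - w s(o, a) * (1 - w s(o, b)) * w s(o, c)) *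
          (prodBernoulli w).real {ω | ¬ (openGraph (ω ∩ {e | o ∉ e})).Reachable a b ∧
            ¬ (openGraph (ω ∩ {e | o ∉ e})).Reachable a c ∧ ¬ (openGraph (ω ∩ {e | o ∉ e})).Reachable b c} ≤
        (((w s(o, a) : ℝ) - w s(o, b)) + w s(o, c) * (1 - w s(o, a))) *
          (prodBernoulli w).real {ω | (openGraph (ω ∩ {e | o ∉ e})).Reachable a c ∧ ¬ (openGraph (ω ∩ {e | o ∉ e})).Reachable a b} ∨
      ((1 - (w s(o, a) : ℝ)) * w s(o, c) * (1 - w s(o, b)) - w s(o, a) * (1 - w s(o, c)) * w s(o, b)) *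
          (prodBernoulli w).real {ω | ¬ (openGraph (ω ∩ {e | o ∉ e})).Reachable a b ∧
            ¬ (openGraph (ω ∩ {e | o ∉ e})).Reachable a c ∧ ¬ (openGraph (ω ∩ {e | o ∉ e})).Reachable b c} ≤
        (((w s(o, a) : ℝ) - w s(o, c)) + w s(o, b) * (1 - w s(o, a))) *
          (prodBernoulli w).real {ω | (openGraph (ω ∩ {e | o ∉ e})).Reachable a b ∧ ¬ (openGraph (ω ∩ {e | o ∉ e})).Reachable a c})
    (ht : (prodBernoulli w).real (openConn o a)ᶜ ≤ t) :
    (prodBernoulli w).real {ω : BondConfig (Fin n) | (R.filter fun v => ω ∈ openConn o v).card ≤ 1} ≤ t := by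
  have hP : (prodBernoulli w).real {ω | ω ∈ openConn o a ∧ ω ∉ openConn o b ∧ ω ∉ openConn o c} ≤
      (prodBernoulli w).real {ω | ω ∉ openConn o a ∧ ω ∈ openConn o b ∧ ω ∈ openConn o c} := by
    rcases hABC with hA | hB | hC
    · exact single_le_pair_of_star w o a b c hao hbo hco hab hac hbc hobs hqab hA
    · exact single_le_pair_of_transfer_b w o a b c hao hbo hco hab hac hbc hobs hqab hB
    · exact single_le_pair_of_transfer_c w o a b c hao hbo hco hab hac hbc hobs hqac hC
  have ha : a ∈ R := by simp [hR]
  have hb : b ∈ R := by simp [hR]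
  have hc : c ∈ R := by simp [hR]
  exact (OneCutFive.measureReal_le_one_le_compl_of_exchange w R o a b c ha hb hc hab hac hbc hP).trans ht

end Transfer

end ThreePort

end Summit.CriticalPhenomena.PercolationContinuityZ3.Theorems

end
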